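import Summits.QuantumFields.YangMills.Theorems.MirrorModularBoostsHypercubicLimitPeelDecayLattice
import Summits.QuantumFields.YangMills.Theorems.MirrorModularBoostsHypercubicLimitPeelDecayMoving
import Summits.QuantumFields.YangMills.Theorems.LangevinControlUVOSLegsFromFemtoAndGapDefsR3
import Summits.QuantumFields.YangMills.Theorems.PencilRigidityNPointIsotropyUnorderedRPTransport
import Summits.QuantumFields.YangMills.Theorems.PencilRigidityWeakCouplingHypercubicLimitDecaySupport
import HarnessLib

/-!
# Crux `HypercubicLimit` (stmt-QuantumFields-16154), line `peel-and-disseminate`: (R3b) decay of the diagonal connected OS form of the one-field limits from RP-spectral slab clustering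

Support file (c3 seat) proving the registered piece (R3b) `stub_decayOfSlabClustering` of the reflection leg (R):
for a `SoftData` witness with `PolyRenorm`, tori `a_k⁻² ≤ L_k`, a slack `ε_k = o(a_k^p)` for every `p`, and the
RP-spectral slab clustering of `GapData` (iii) ALONG THE SCHEME (eventually in `k`, every bounded measurable slab
functional `Y` read through the periodic lift), the one-field limit has `Decay S₁ 1`:
`Re conn(F, T_t F) ≤ Re conn(F, F) e^{−t}` for real, off-diagonal, positive-time, compactly supported `F`, `t ≥ 0`
(the decay input of the landed continuum assembly `reflHalf_of_pieces`; with (R3a) `RPPos S₁` it gives E4 + gap).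

Route (`decay_of_slabClustering`), level `k`, `a = a_k`, `L = L_k`, `λ = c_k a⁴`: the slab functional is
`Y_k = λⁿ Re C_F`, `C_F = rpLat r L a ⟨p⟩ F` (`…PeelDecayDefs.lean`) — real (`conj_rpLat`), measurable, bounded by
`K₀ a^{−(Q+4)n}` (`norm_rpLat_le`, `rp_sum_norm_le`, `PolyRenorm`), living on the slab of height `⌊ρ/a⌋ + 3`
(`rpLat_dependsOn_slab`); with the lattice time `n_k = 2⌊t/2a⌋` (`n_k a → t`) the three integrals of the slab
inequality are `rpFam_k n F`, `rpFam_k (2n) (ΘF* ⊗ F)`, `rpFam_k (2n) (ΘF* ⊗ T_{n_k a e₀} F)` (`rpFam_eq_integral`,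
`rpFam_pair_eq_integral`, `rpLat_configShift` — no wrap-around since eventually `2(T_k + n_k + 1) ≤ L_k`;
`…PeelDecayLattice.lean`); limits by `tendsto_rpFam` on `⁰𝒮` (`isOffDiagonal_osAdjoint_appendTensor`), the
moving tensor `ΘF* ⊗ T_{n_k a}F → ΘF* ⊗ T_t F` by the equicontinuity `norm_rpFam_le_eventually`
(`…PeelDecayMoving.lean`), `e^{−a n_k} → e^{−t}`, `ε_k K₀² a_k^{−2p} → 0`, `le_of_tendsto_of_tendsto`; finally
`S₁ n (T_t F) = S₁ n F` (translation invariance of the `Spl`), `S₁ n (ΘF*) = conj (S₁ n F)` (exact lattice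
hermiticity `rpFam_osAdjoint` for every `F`) and `Im S₁ n F = 0`.  Conventions (checked): `configShift (−n e₀)`
reads the configuration `n` steps later in time and matches `translateMulti ((n a) e₀)`.

Refs: OsterwalderSeiler1978 §§2–3; GlimmJaffe1987 §6.1, §19.7; OsterwalderSchrader1973 §4;
`PencilRigidityHypercubicLimitDefs.lean` §2 (iii), §7; the twin `stub_decayOfRPSpectral` (crux 16120).
-/

set_option autoImplicit false
noncomputable section
open scoped SchwartzMap ENNReal ComplexConjugate
open MeasureTheory Filter Topology
open Literature.MathematicalPhysics.AQFT Literature.MathematicalPhysics.QuantumLattice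
open Literature.MathematicalPhysics.QuantumFieldTheory
open Literature.Probability.LatticeModels (box Site)
open Summit.QuantumFields.YangMills.Cruxes.HypercubicLimit.ConditionalMeanTelescoping
open Summit.QuantumFields.YangMills.Cruxes.OSLegsFromFemtoAndGap.DlrCollarTransfer (plane conn Decay)
open Summit.QuantumFields.YangMills.Theorems.NPointIsotropy.QuarterTurnCornerOperator.UnorderedRP
  (isOffDiagonal_osAdjoint_appendTensor)
open Summit.QuantumFields.YangMills.Theorems.WeakCouplingHypercubicLimit.TraceNormColdPressure
  (latticeTime_facts smul_single_one_eq exists_radius)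

namespace Summit.QuantumFields.YangMills.Cruxes.HypercubicLimit.PeelAndDisseminate

variable {G : Type} [Group G] [TopologicalSpace G] [IsTopologicalGroup G] [CompactSpace G]
  [MeasurableSpace G] [BorelSpace G]

/-- **(R3b) with the torus lower bound and the slack explicit.**  For a `SoftData` witness with `PolyRenorm`,
tori `a_k⁻² ≤ L_k`, a slack `ε_k` decaying faster than every power of `a_k`, and the RP-spectral slab clustering
inequality of `GapData` (iii) along the scheme (eventually in `k`, every bounded measurable slab functional), the
diagonal connected OS form of the one-field limit decays at rate `1`: `Re conn(F, T_t F) ≤ Re conn(F, F) e^{−t}`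
for real, off-diagonal, positive-time, compactly supported `F` and `t ≥ 0`. -/
theorem decay_of_slabClustering (r : LatticeRep G) {β₁ C₁ c₂ : ℝ} {m : ℝ → ℝ}
    (hgap : GapData G r β₁ C₁ c₂ m) {Λ : ℝ → ℕ → ℕ} {δ₀ : ℝ} {sch : SpeciesScheme (YMSpecies G)}
    {S₁ : SchwingerFamily (EuclideanSpace ℝ (Fin 4))}
    {Spl : (n : ℕ) → (Fin n → Fin 4 × Fin 4) → (𝓢((Fin n → EuclideanSpace ℝ (Fin 4)), ℂ) →L[ℂ] ℂ)}
    (hD : SoftData r m δ₀ Λ sch S₁ Spl) (hP : PolyRenorm r sch)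
    (hL2 : ∀ k, (sch.a k)⁻¹ * (sch.a k)⁻¹ ≤ (sch.L k : ℝ))
    {ε : ℕ → ℝ} (hε : ∀ p : ℕ, Tendsto (fun k => ε k * (sch.a k)⁻¹ ^ p) atTop (𝓝 0))
    (hslab : ∀ᶠ k in atTop, ∀ (T n : ℕ), 2 * (T + n + 1) ≤ sch.L k →
      ∀ (Y : LGConfig 4 G → ℝ) (B : ℝ), Measurable Y → (∀ U, |Y U| ≤ B) →
        DependsOn Y {e : Literature.MathematicalPhysics.QuantumLattice.ZdEdge 4 |
            1 ≤ e.1 0 ∧ e.1 0 + (if e.2 = 0 then 1 else 0) ≤ T} →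
          |(∫ U, Y (torusLift (2 * sch.L k + 1) (GaugeConfig.timeReflect U)) *
                Y (configShift (-Pi.single 0 (n : ℤ)) (torusLift (2 * sch.L k + 1) U))
              ∂(wilsonMeasure r.ρ (sch.β k) : Measure (GaugeConfig 4 (2 * sch.L k + 1) G))) -
            (∫ U, Y (torusLift (2 * sch.L k + 1) U)
              ∂(wilsonMeasure r.ρ (sch.β k) : Measure (GaugeConfig 4 (2 * sch.L k + 1) G))) ^ 2| ≤
            Real.exp (-(m (sch.β k) * n)) *
                ((∫ U, Y (torusLift (2 * sch.L k + 1) (GaugeConfig.timeReflect U)) *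
                      Y (torusLift (2 * sch.L k + 1) U)
                    ∂(wilsonMeasure r.ρ (sch.β k) : Measure (GaugeConfig 4 (2 * sch.L k + 1) G))) -
                  (∫ U, Y (torusLift (2 * sch.L k + 1) U)
                    ∂(wilsonMeasure r.ρ (sch.β k) : Measure (GaugeConfig 4 (2 * sch.L k + 1) G))) ^ 2) +
              ε k * B ^ 2) :
    Decay S₁ 1 := by
  classical
  obtain ⟨hunits, hβ, -, -, hc, -, hSpl, -, hexp, hS0, hS1, ⟨K, γ, s, hK, hUB, -, -⟩, -, htransl⟩ := hD
  obtain ⟨Q, hQ⟩ := hP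
  -- §a scheme facts
  have ha0 : Tendsto sch.a atTop (𝓝 0) := (hgap.2.1.comp hβ).congr fun k => (hunits k).symm
  have hapos : ∀ᶠ k in atTop, 0 < sch.a k := Eventually.of_forall sch.a_pos
  have ha1 : ∀ᶠ k in atTop, sch.a k ≤ 1 := ha0.eventually_le_const one_pos
  have hc0 : ∀ k, 0 ≤ sch.c r.curvature k := fun k => by rw [hc k]; exact inv_nonneg.2 (Real.sqrt_nonneg _)
  have hlam0 : ∀ k, 0 ≤ sch.c r.curvature k * sch.a k ^ 4 := fun k => mul_nonneg (hc0 k) (by positivity)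
  have hlamQ : ∀ k, sch.a k ≤ 1 → sch.c r.curvature k * sch.a k ^ 4 ≤ ((sch.a k)⁻¹) ^ Q := fun k hk1 =>
    calc sch.c r.curvature k * sch.a k ^ 4 ≤ sch.c r.curvature k * 1 :=
          mul_le_mul_of_nonneg_left (pow_le_one₀ (sch.a_pos k).le hk1) (hc0 k)
      _ ≤ ((sch.a k)⁻¹) ^ Q := by rw [mul_one]; exact hQ k
  have hconv := tendsto_rpFam r sch S₁ Spl hK ha0 hapos (Eventually.of_forall hL2) hc0 hQ hSpl hexp hS0 hS1 hUB
  -- translation invariance of `S₁` on `⁰𝒮`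
  have htrans : ∀ (n : ℕ) (v : EuclideanSpace ℝ (Fin 4)) (F : 𝓢((Fin n → EuclideanSpace ℝ (Fin 4)), ℂ)),
      IsOffDiagonal F → S₁ n (translateMulti v F) = S₁ n F := by
    intro n v F hF
    rcases Nat.lt_or_ge n 2 with hn | hn
    · interval_cases n
      · rw [hS0, hS0, translateMulti_apply]
        exact congrArg F (Subsingleton.elim _ _)
      · rw [hS1, hS1]
    · rw [hexp n hn _ (hF.translateMulti v), hexp n hn F hF]
      exact Finset.sum_congr rfl fun q _ => htransl n q v F hF
  -- §b the test function, the lattice times and the OS tensors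
  intro n F hFo hFp hFc hFr t ht
  obtain ⟨ρ, hρ, hFρ⟩ := exists_radius hFc
  have hFp' : tsupport (F : (Fin n → EuclideanSpace ℝ (Fin 4)) → ℂ) ⊆ {u | ∀ l, 0 < u l 0} := hFp
  set jj : ℕ → ℕ := fun k => 2 * ⌊t / (2 * sch.a k)⌋₊ with hjj
  set vv : ℕ → EuclideanSpace ℝ (Fin 4) := fun k =>
    (((jj k : ℕ) : ℝ) * sch.a k) • EuclideanSpace.single (0 : Fin 4) (1 : ℝ) with hvv
  set Tk : ℕ → ℕ := fun k => ⌊ρ / sch.a k⌋₊ + 3 with hTk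
  set Y : ℕ → LGConfig 4 G → ℝ := fun k V => (sch.c r.curvature k * sch.a k ^ 4) ^ n *
    (rpLat r (sch.L k) (sch.a k) (fun q => wilsonTorusMean r.ρ (sch.β k) (sch.L k) (planeObs r q.1)) F V).re
    with hY
  set H0 : 𝓢((Fin (n + n) → EuclideanSpace ℝ (Fin 4)), ℂ) := (osAdjoint F).appendTensor F with hH0
  set Hk : ℕ → 𝓢((Fin (n + n) → EuclideanSpace ℝ (Fin 4)), ℂ) := fun k =>
    (osAdjoint F).appendTensor (translateMulti (vv k) F) with hHk
  set Hoo : 𝓢((Fin (n + n) → EuclideanSpace ℝ (Fin 4)), ℂ) :=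
    (osAdjoint F).appendTensor (translateMulti (EuclideanSpace.single (0 : Fin 4) t) F) with hHoo
  have hjb : ∀ k, t - 2 * sch.a k ≤ ((jj k : ℕ) : ℝ) * sch.a k ∧ ((jj k : ℕ) : ℝ) * sch.a k ≤ t :=
    (latticeTime_facts ht sch.a_pos ha0).1
  have hcoef : Tendsto (fun k => ((jj k : ℕ) : ℝ) * sch.a k) atTop (𝓝 t) :=
    (latticeTime_facts ht sch.a_pos ha0).2
  have hvv_lim : Tendsto vv atTop (𝓝 (EuclideanSpace.single (0 : Fin 4) t)) := by
    have h := hcoef.smul_const (EuclideanSpace.single (0 : Fin 4) (1 : ℝ))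
    rwa [smul_single_one_eq] at h
  have hvv0 : ∀ k, 0 ≤ vv k 0 := fun k => by
    have h1 : vv k 0 = ((jj k : ℕ) : ℝ) * sch.a k := by simp [hvv]
    exact h1 ▸ mul_nonneg (Nat.cast_nonneg _) (sch.a_pos k).le
  have hH0o : IsOffDiagonal H0 := isOffDiagonal_osAdjoint_appendTensor hFp hFo hFp hFo
  have hHko : ∀ k, IsOffDiagonal (Hk k) := fun k =>
    isOffDiagonal_osAdjoint_appendTensor hFp hFo (isPositiveTimeMulti_translateMulti hFp (hvv0 k))
      (hFo.translateMulti _)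
  have ht0 : (0 : ℝ) ≤ (EuclideanSpace.single (0 : Fin 4) t : EuclideanSpace ℝ (Fin 4)) 0 := by simpa using ht
  have hHooo : IsOffDiagonal Hoo := isOffDiagonal_osAdjoint_appendTensor hFp hFo
    (isPositiveTimeMulti_translateMulti hFp ht0) (hFo.translateMulti _)
  have hHk_lim : Tendsto Hk atTop (𝓝 Hoo) :=
    SchwartzMap.tendsto_appendTensor tendsto_const_nhds (((continuous_translateMulti F).tendsto _).comp hvv_lim)
  -- §c the lattice functional: realness, measurability, bound, slab support
  have hYc : ∀ k V, ((Y k V : ℝ) : ℂ) = (((sch.c r.curvature k * sch.a k ^ 4) ^ n : ℝ) : ℂ) *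
      rpLat r (sch.L k) (sch.a k) (fun q => wilsonTorusMean r.ρ (sch.β k) (sch.L k) (planeObs r q.1)) F V := by
    intro k V
    have hre := Complex.conj_eq_iff_re.1 (conj_rpLat r (sch.L k) (sch.a k)
      (fun q => wilsonTorusMean r.ρ (sch.β k) (sch.L k) (planeObs r q.1)) hFr V)
    simp only [hY]; push_cast; rw [hre]
  have hYm : ∀ k, Measurable (Y k) := fun k =>
    (Complex.measurable_re.comp (measurable_rpLat r _ _ _ F)).const_mul _
  obtain ⟨Cp, hCp⟩ := Cruxes.OSLegsFromFemtoAndGap.DlrCollarTransfer.exists_abs_plane_le (G := G) r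
  have hCN : 0 ≤ Cp + r.N := add_nonneg ((abs_nonneg _).trans (hCp (0, 1) 0 fun _ => 1)) (Nat.cast_nonneg _)
  set K₀ : ℝ := (Cp + r.N) ^ n * ((Fintype.card (Fin n → {q : Fin 4 × Fin 4 // q.1 < q.2}) : ℝ) *
    ((2 * ρ + 7) ^ (4 * n) * SchwartzMap.seminorm ℂ 0 0 F)) with hK₀
  set p : ℕ := Q * n + 4 * n with hp
  have hYB : ∀ k, sch.a k ≤ 1 → ∀ V, |Y k V| ≤ K₀ * ((sch.a k)⁻¹) ^ p := by
    intro k hk1 V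
    have ha := sch.a_pos k
    have h1 : |Y k V| ≤ (sch.c r.curvature k * sch.a k ^ 4) ^ n *
        ‖rpLat r (sch.L k) (sch.a k) (fun q => wilsonTorusMean r.ρ (sch.β k) (sch.L k) (planeObs r q.1)) F V‖ := by
      simp only [hY]
      rw [abs_mul, abs_of_nonneg (pow_nonneg (hlam0 k) n)]
      exact mul_le_mul_of_nonneg_left (Complex.abs_re_le_norm _) (pow_nonneg (hlam0 k) n)
    have h2 := norm_rpLat_le r (sch.L k) (sch.a k) F hCp
      (fun q => abs_wilsonTorusMean_planeObs_le r (sch.β k) (sch.L k) q.1) V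
    have hcard : ∑ q : Fin n → {q : Fin 4 × Fin 4 // q.1 < q.2},
        ∑ x ∈ Fintype.piFinset (fun k' => rpDom (sch.L k) (q k')), ‖F (fun k' => rpPoint (sch.a k) (q k') (x k'))‖ ≤
        (Fintype.card (Fin n → {q : Fin 4 × Fin 4 // q.1 < q.2}) : ℝ) *
          ((2 * (ρ / sch.a k + 2) + 3) ^ (4 * n) * SchwartzMap.seminorm ℂ 0 0 F) := by
      calc _ ≤ ∑ _q : Fin n → {q : Fin 4 × Fin 4 // q.1 < q.2},
            (2 * (ρ / sch.a k + 2) + 3) ^ (4 * n) * SchwartzMap.seminorm ℂ 0 0 F :=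
            Finset.sum_le_sum fun q _ => rp_sum_norm_le (by positivity) F q
              (fun x hx l i => (rp_string_support ha hFρ hFp' q x hx l).2 i)
        _ = _ := by rw [Finset.sum_const, Finset.card_univ, nsmul_eq_mul]
    have h3 : 2 * (ρ / sch.a k + 2) + 3 ≤ (2 * ρ + 7) * (sch.a k)⁻¹ := by
      rw [le_mul_inv_iff₀ ha]
      have h := div_mul_cancel₀ ρ ha.ne'
      nlinarith
    have h4 : (2 * (ρ / sch.a k + 2) + 3) ^ (4 * n) ≤ ((2 * ρ + 7) * (sch.a k)⁻¹) ^ (4 * n) :=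
      pow_le_pow_left₀ (by positivity) h3 _
    have h5 : (sch.c r.curvature k * sch.a k ^ 4) ^ n ≤ ((sch.a k)⁻¹ ^ Q) ^ n :=
      pow_le_pow_left₀ (hlam0 k) (hlamQ k hk1) n
    have hS0' : 0 ≤ SchwartzMap.seminorm ℂ 0 0 F := apply_nonneg _ _
    have hsum0 : 0 ≤ ∑ q : Fin n → {q : Fin 4 × Fin 4 // q.1 < q.2},
        ∑ x ∈ Fintype.piFinset (fun k' => rpDom (sch.L k) (q k')), ‖F (fun k' => rpPoint (sch.a k) (q k') (x k'))‖ :=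
      Finset.sum_nonneg fun q _ => Finset.sum_nonneg fun x _ => norm_nonneg _
    calc |Y k V| ≤ (sch.c r.curvature k * sch.a k ^ 4) ^ n * ((Cp + r.N) ^ n *
          ∑ q : Fin n → {q : Fin 4 × Fin 4 // q.1 < q.2},
            ∑ x ∈ Fintype.piFinset (fun k' => rpDom (sch.L k) (q k')),
              ‖F (fun k' => rpPoint (sch.a k) (q k') (x k'))‖) :=
          h1.trans (mul_le_mul_of_nonneg_left h2 (pow_nonneg (hlam0 k) n))
      _ ≤ ((sch.a k)⁻¹ ^ Q) ^ n * ((Cp + r.N) ^ n *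
          ((Fintype.card (Fin n → {q : Fin 4 × Fin 4 // q.1 < q.2}) : ℝ) *
            (((2 * ρ + 7) * (sch.a k)⁻¹) ^ (4 * n) * SchwartzMap.seminorm ℂ 0 0 F))) := by
          refine mul_le_mul h5 (mul_le_mul_of_nonneg_left (hcard.trans ?_) (pow_nonneg hCN n))
            (mul_nonneg (pow_nonneg hCN n) hsum0) (by positivity)
          exact mul_le_mul_of_nonneg_left (mul_le_mul_of_nonneg_right h4 hS0') (Nat.cast_nonneg _)
      _ = K₀ * ((sch.a k)⁻¹) ^ p := by
          simp only [hK₀, hp]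
          rw [mul_pow, ← pow_mul, pow_add]
          ring
  have hYd : ∀ k, DependsOn (Y k) {e : Literature.MathematicalPhysics.QuantumLattice.ZdEdge 4 |
      1 ≤ e.1 0 ∧ e.1 0 + (if e.2 = 0 then 1 else 0) ≤ Tk k} := by
    intro k
    have hsl : ∀ (q : Fin n → {q : Fin 4 × Fin 4 // q.1 < q.2}) (x : Fin n → (Fin 4 → ℤ)),
        F (fun l => rpPoint (sch.a k) (q l) (x l)) ≠ 0 → ∀ l, 1 ≤ x l 0 ∧ x l 0 + 1 ≤ ((Tk k : ℕ) : ℤ) := by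
      intro q x h0 l
      have h := rp_string_support (sch.a_pos k) hFρ hFp' q x h0 l
      refine ⟨h.1, ?_⟩
      have h1 : ((x l 0 : ℤ) : ℝ) ≤ ρ / sch.a k + 2 := (le_abs_self _).trans (h.2 0)
      have h2 : ρ / sch.a k < (⌊ρ / sch.a k⌋₊ : ℕ) + 1 := Nat.lt_floor_add_one _
      have h3 : ((x l 0 : ℤ) : ℝ) < ((Tk k : ℕ) : ℝ) := by simp only [hTk]; push_cast; linarith
      have h4 : x l 0 < ((Tk k : ℕ) : ℤ) := by exact_mod_cast h3
      omega
    have hdep := rpLat_dependsOn_slab r (sch.L k) (sch.a k)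
      (fun q => wilsonTorusMean r.ρ (sch.β k) (sch.L k) (planeObs r q.1)) F hsl
    intro U V hUV
    simp only [hY]
    rw [hdep hUV]
  -- §d the three lattice quantities are the RP-adapted pairings
  have hE1 : ∀ k, rpFam r (sch.β k) (sch.L k) (sch.a k) (sch.c r.curvature k * sch.a k ^ 4) n F =
      ((∫ U, Y k (torusLift (2 * sch.L k + 1) U)
        ∂(wilsonMeasure r.ρ (sch.β k) : Measure (GaugeConfig 4 (2 * sch.L k + 1) G)) : ℝ) : ℂ) := by
    intro k
    rw [rpFam_eq_integral, ← integral_complex_ofReal]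
    exact integral_congr_ae (ae_of_all _ fun U => (hYc k _).symm)
  have hE2 : ∀ k, rpFam r (sch.β k) (sch.L k) (sch.a k) (sch.c r.curvature k * sch.a k ^ 4) (n + n) H0 =
      ((∫ U, Y k (torusLift (2 * sch.L k + 1) (GaugeConfig.timeReflect U)) * Y k (torusLift (2 * sch.L k + 1) U)
        ∂(wilsonMeasure r.ρ (sch.β k) : Measure (GaugeConfig 4 (2 * sch.L k + 1) G)) : ℝ) : ℂ) := by
    intro k
    simp only [hH0]
    rw [rpFam_pair_eq_integral, ← integral_complex_ofReal]
    refine integral_congr_ae (ae_of_all _ fun U => ?_)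
    dsimp only
    rw [conj_rpLat r _ _ _ hFr, Complex.ofReal_mul, hYc, hYc]
    push_cast; ring
  have hE4 : ∀ k, rpFam r (sch.β k) (sch.L k) (sch.a k) (sch.c r.curvature k * sch.a k ^ 4) n (osAdjoint F) =
      conj (rpFam r (sch.β k) (sch.L k) (sch.a k) (sch.c r.curvature k * sch.a k ^ 4) n F) :=
    fun k => rpFam_osAdjoint r _ _ _ _ n F
  -- §e eventual geometry: the slab, the translate and the gap fit in the torus
  have hsmall : ∀ᶠ k in atTop, sch.a k ≤ 1 / (2 * ρ + 2 * t + 8) :=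
    ha0.eventually_le_const (by positivity)
  have hgeom : ∀ᶠ k in atTop, 2 * (Tk k + jj k + 1) ≤ sch.L k := by
    filter_upwards [hsmall, ha1] with k hk hk1
    have ha := sch.a_pos k
    have hT : ((Tk k : ℕ) : ℝ) * sch.a k ≤ ρ + 3 * sch.a k := by
      have hfl : ((⌊ρ / sch.a k⌋₊ : ℕ) : ℝ) ≤ ρ / sch.a k := Nat.floor_le (div_nonneg hρ ha.le)
      have h1 : ((Tk k : ℕ) : ℝ) ≤ ρ / sch.a k + 3 := by simp only [hTk]; push_cast; linarith
      have h2 := mul_le_mul_of_nonneg_right h1 ha.le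
      rwa [add_mul, div_mul_cancel₀ _ ha.ne'] at h2
    have hj : ((jj k : ℕ) : ℝ) * sch.a k ≤ t := (hjb k).2
    have hcinv : 2 * ρ + 2 * t + 8 ≤ (sch.a k)⁻¹ := by rw [← one_div]; exact (le_one_div (by positivity) ha).2 hk
    have hreal : ((2 * (Tk k + jj k + 1) : ℕ) : ℝ) * sch.a k ≤ (sch.a k)⁻¹ * (sch.a k)⁻¹ * sch.a k := by
      rw [inv_mul_cancel_right₀ ha.ne']; push_cast; nlinarith
    have h := (le_of_mul_le_mul_right hreal ha).trans (hL2 k)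
    exact_mod_cast h
  have hE3 : ∀ᶠ k in atTop,
      rpFam r (sch.β k) (sch.L k) (sch.a k) (sch.c r.curvature k * sch.a k ^ 4) (n + n) (Hk k) =
        ((∫ U, Y k (torusLift (2 * sch.L k + 1) (GaugeConfig.timeReflect U)) *
            Y k (configShift (-Pi.single 0 ((jj k : ℕ) : ℤ)) (torusLift (2 * sch.L k + 1) U))
          ∂(wilsonMeasure r.ρ (sch.β k) : Measure (GaugeConfig 4 (2 * sch.L k + 1) G)) : ℝ) : ℂ) := by
    filter_upwards [hgeom] with k hgk
    have ha := sch.a_pos k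
    have hBL : ρ / sch.a k + 2 + ((jj k : ℕ) : ℝ) ≤ (sch.L k : ℝ) := by
      have h1 : Tk k + jj k ≤ sch.L k := by omega
      have h2 : ((Tk k : ℕ) : ℝ) + ((jj k : ℕ) : ℝ) ≤ (sch.L k : ℝ) := by exact_mod_cast h1
      have h3 : ρ / sch.a k < (⌊ρ / sch.a k⌋₊ : ℕ) + 1 := Nat.lt_floor_add_one _
      have h4 : ((Tk k : ℕ) : ℝ) = (⌊ρ / sch.a k⌋₊ : ℕ) + 3 := by simp only [hTk]; push_cast; ring
      linarith
    have hsupp : ∀ (q : Fin n → {q : Fin 4 × Fin 4 // q.1 < q.2}) (x : Fin n → (Fin 4 → ℤ)),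
        F (fun l => rpPoint (sch.a k) (q l) (x l)) ≠ 0 →
          ∀ l, x l ∈ rpDom (sch.L k) (q l) ∧ x l + Pi.single 0 ((jj k : ℕ) : ℤ) ∈ rpDom (sch.L k) (q l) :=
      fun q x h0 l => rp_mem_rpDom (rp_string_support ha hFρ hFp' q x h0 l).1
        (rp_string_support ha hFρ hFp' q x h0 l).2 hBL (q l)
    simp only [hHk, hvv]
    rw [rpFam_pair_eq_integral, ← integral_complex_ofReal]
    refine integral_congr_ae (ae_of_all _ fun U => ?_)
    dsimp only
    rw [conj_rpLat r _ _ _ hFr, ← rpLat_configShift r (sch.L k) (sch.a k) _ (jj k) F hsupp,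
      Complex.ofReal_mul, hYc, hYc]
    push_cast; ring
  -- §f the slab clustering inequality along the scheme
  have hineq : ∀ᶠ k in atTop,
      (∫ U, Y k (torusLift (2 * sch.L k + 1) (GaugeConfig.timeReflect U)) *
            Y k (configShift (-Pi.single 0 ((jj k : ℕ) : ℤ)) (torusLift (2 * sch.L k + 1) U))
          ∂(wilsonMeasure r.ρ (sch.β k) : Measure (GaugeConfig 4 (2 * sch.L k + 1) G))) -
        (∫ U, Y k (torusLift (2 * sch.L k + 1) U)
          ∂(wilsonMeasure r.ρ (sch.β k) : Measure (GaugeConfig 4 (2 * sch.L k + 1) G))) ^ 2 ≤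
      Real.exp (-(sch.a k * ((jj k : ℕ) : ℝ))) *
          ((∫ U, Y k (torusLift (2 * sch.L k + 1) (GaugeConfig.timeReflect U)) *
                Y k (torusLift (2 * sch.L k + 1) U)
              ∂(wilsonMeasure r.ρ (sch.β k) : Measure (GaugeConfig 4 (2 * sch.L k + 1) G))) -
            (∫ U, Y k (torusLift (2 * sch.L k + 1) U)
              ∂(wilsonMeasure r.ρ (sch.β k) : Measure (GaugeConfig 4 (2 * sch.L k + 1) G))) ^ 2) +
        ε k * (K₀ * ((sch.a k)⁻¹) ^ p) ^ 2 := by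
    filter_upwards [hslab, hgeom, ha1] with k hk hgk hk1
    have h := hk (Tk k) (jj k) hgk (Y k) (K₀ * ((sch.a k)⁻¹) ^ p) (hYm k) (hYB k hk1) (hYd k)
    rw [← hunits k] at h
    exact (le_abs_self _).trans h
  -- §g limits
  obtain ⟨C, P, hb⟩ := norm_rpFam_le_eventually r sch hK ha0 hapos (Eventually.of_forall hL2) hc0 hQ hUB (n + n)
  have hP2 : Tendsto (fun k => rpFam r (sch.β k) (sch.L k) (sch.a k) (sch.c r.curvature k * sch.a k ^ 4)
      (n + n) (Hk k)) atTop (𝓝 (S₁ (n + n) Hoo)) :=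
    tendsto_apply_of_tendsto_offDiagonal
      (S := fun k => rpFam r (sch.β k) (sch.L k) (sch.a k) (sch.c r.curvature k * sch.a k ^ 4) (n + n))
      (T := S₁ (n + n)) (fun H hH => hconv (n + n) H hH) hb hHko hHooo hHk_lim
  have hA2 : Tendsto (fun k => ∫ U, Y k (torusLift (2 * sch.L k + 1) (GaugeConfig.timeReflect U)) *
        Y k (configShift (-Pi.single 0 ((jj k : ℕ) : ℤ)) (torusLift (2 * sch.L k + 1) U))
      ∂(wilsonMeasure r.ρ (sch.β k) : Measure (GaugeConfig 4 (2 * sch.L k + 1) G)))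
      atTop (𝓝 (S₁ (n + n) Hoo).re) := by
    refine ((Complex.continuous_re.tendsto _).comp hP2).congr' (hE3.mono fun k hk => ?_)
    rw [Function.comp_apply, hk, Complex.ofReal_re]
  have hA0 : Tendsto (fun k => ∫ U, Y k (torusLift (2 * sch.L k + 1) (GaugeConfig.timeReflect U)) *
        Y k (torusLift (2 * sch.L k + 1) U)
      ∂(wilsonMeasure r.ρ (sch.β k) : Measure (GaugeConfig 4 (2 * sch.L k + 1) G)))
      atTop (𝓝 (S₁ (n + n) H0).re) := by
    refine ((Complex.continuous_re.tendsto _).comp (hconv (n + n) H0 hH0o)).congr fun k => ?_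
    rw [Function.comp_apply, hE2 k, Complex.ofReal_re]
  have hA1 : Tendsto (fun k => ∫ U, Y k (torusLift (2 * sch.L k + 1) U)
      ∂(wilsonMeasure r.ρ (sch.β k) : Measure (GaugeConfig 4 (2 * sch.L k + 1) G)))
      atTop (𝓝 (S₁ n F).re) := by
    refine ((Complex.continuous_re.tendsto _).comp (hconv n F hFo)).congr fun k => ?_
    rw [Function.comp_apply, hE1 k, Complex.ofReal_re]
  have him : (S₁ n F).im = 0 := by
    have h := (Complex.continuous_im.tendsto _).comp (hconv n F hFo)
    refine tendsto_nhds_unique h (tendsto_const_nhds.congr fun k => ?_)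
    rw [Function.comp_apply, hE1 k, Complex.ofReal_im]
  have hadj : S₁ n (osAdjoint F) = conj (S₁ n F) := by
    have h1 := hconv n (osAdjoint F) hFo.osAdjoint
    have h2 : Tendsto (fun k => conj (rpFam r (sch.β k) (sch.L k) (sch.a k) (sch.c r.curvature k * sch.a k ^ 4)
        n F)) atTop (𝓝 (conj (S₁ n F))) := (Complex.continuous_conj.tendsto _).comp (hconv n F hFo)
    exact tendsto_nhds_unique h1 (h2.congr fun k => (hE4 k).symm)
  have hE : Tendsto (fun k => Real.exp (-(sch.a k * ((jj k : ℕ) : ℝ)))) atTop (𝓝 (Real.exp (-t))) := by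
    have h1 : Tendsto (fun k => -(sch.a k * ((jj k : ℕ) : ℝ))) atTop (𝓝 (-t)) :=
      hcoef.neg.congr fun k => by ring
    exact (Real.continuous_exp.tendsto _).comp h1
  have hTh : Tendsto (fun k => ε k * (K₀ * ((sch.a k)⁻¹) ^ p) ^ 2) atTop (𝓝 0) := by
    have h := (hε (2 * p)).mul_const (K₀ ^ 2)
    rw [zero_mul] at h
    exact h.congr fun k => by ring
  have hlim := le_of_tendsto_of_tendsto (hA2.sub (hA1.pow 2)) ((hE.mul (hA0.sub (hA1.pow 2))).add hTh) hineq
  rw [add_zero] at hlim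
  -- §h conclusion
  have hre2 : ∀ z : ℂ, z.im = 0 → (conj z * z).re = z.re ^ 2 := fun z hz => by
    simp only [Complex.mul_re, Complex.conj_re, Complex.conj_im, hz, neg_zero, mul_zero, sub_zero]
    ring
  simp only [conn]
  rw [htrans n _ F hFo, hadj, Complex.sub_re, Complex.sub_re, hre2 _ him, one_mul]
  simp only [hHoo, hH0] at hlim
  exact hlim.trans_eq (mul_comm _ _)

/-- **(R3b) Exponential decay at rate `1` of the diagonal connected OS form of the one-field limits of the host
closure from RP-spectral slab clustering along the scheme** (registered stub of line `peel-and-disseminate`,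
crux stmt-QuantumFields-16154): `decay_of_slabClustering`. -/
theorem stub_decayOfSlabClustering :
    ∀ (G : Type) [Group G] [TopologicalSpace G] [IsTopologicalGroup G] [CompactSpace G]
      [MeasurableSpace G] [BorelSpace G] (r : LatticeRep G) (β₁ C₁ c₂ : ℝ) (m : ℝ → ℝ), GapData G r β₁ C₁ c₂ m →
      ∀ (δ₀ : ℝ) (Λ : ℝ → ℕ → ℕ) (sch : SpeciesScheme (YMSpecies G)) (S₁ : SchwingerFamily (EuclideanSpace ℝ (Fin 4)))
        (Spl : (n : ℕ) → (Fin n → Fin 4 × Fin 4) → (𝓢((Fin n → (EuclideanSpace ℝ (Fin 4))), ℂ) →L[ℂ] ℂ)),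
        SoftData r m δ₀ Λ sch S₁ Spl → PolyRenorm r sch →
        (∀ k, 1 ≤ sch.L k) → (∀ k, (sch.a k)⁻¹ * (sch.a k)⁻¹ ≤ (sch.L k : ℝ)) →
        ∀ ε : ℕ → ℝ, (∀ p : ℕ, Tendsto (fun k => ε k * (sch.a k)⁻¹ ^ p) atTop (𝓝 0)) →
          (∀ᶠ k in atTop, ∀ (T n : ℕ), 2 * (T + n + 1) ≤ sch.L k →
            ∀ (Y : LGConfig 4 G → ℝ) (B : ℝ), Measurable Y → (∀ U, |Y U| ≤ B) →
              DependsOn Y {e : Literature.MathematicalPhysics.QuantumLattice.ZdEdge 4 |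
                  1 ≤ e.1 0 ∧ e.1 0 + (if e.2 = 0 then 1 else 0) ≤ T} →
                |(∫ U, Y (torusLift (2 * sch.L k + 1) (GaugeConfig.timeReflect U)) *
                      Y (configShift (-Pi.single 0 (n : ℤ)) (torusLift (2 * sch.L k + 1) U))
                    ∂(wilsonMeasure r.ρ (sch.β k) : Measure (GaugeConfig 4 (2 * sch.L k + 1) G))) -
                  (∫ U, Y (torusLift (2 * sch.L k + 1) U)
                    ∂(wilsonMeasure r.ρ (sch.β k) : Measure (GaugeConfig 4 (2 * sch.L k + 1) G))) ^ 2| ≤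
                  Real.exp (-(m (sch.β k) * n)) *
                      ((∫ U, Y (torusLift (2 * sch.L k + 1) (GaugeConfig.timeReflect U)) *
                            Y (torusLift (2 * sch.L k + 1) U)
                          ∂(wilsonMeasure r.ρ (sch.β k) : Measure (GaugeConfig 4 (2 * sch.L k + 1) G))) -
                        (∫ U, Y (torusLift (2 * sch.L k + 1) U)
                          ∂(wilsonMeasure r.ρ (sch.β k) : Measure (GaugeConfig 4 (2 * sch.L k + 1) G))) ^ 2) +
                    ε k * B ^ 2) →
          Decay S₁ 1 := by
  intro G _ _ _ _ _ _ r β₁ C₁ c₂ m hgap δ₀ Λ sch S₁ Spl hD hP _ hL2 ε hε hslab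
  exact decay_of_slabClustering r hgap hD hP hL2 hε hslab

end Summit.QuantumFields.YangMills.Cruxes.HypercubicLimit.PeelAndDisseminate

end
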